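import Literature.Topology.FourManifolds.FramedBallComplementEven
import Literature.Topology.FourManifolds.FiniteHomogeneity
import Mathlib.Geometry.Manifold.ContMDiffMFDeriv
import HarnessLib

/-!
# A closed manifold framed off a finite set has vanishing cup squares mod `2` and even form

Topic `Literature/Topology/FourManifolds`. A. Kosinski, *Differential Manifolds* (1993), Ch. IX
§8 (almost parallelizable manifolds) with Ch. X Prop. (3.1) (p. 205, evenness); M. Kervaire,
J. Milnor, *Groups of homotopy spheres I*, Ann. of Math. 77 (1963), §7 footnote pp. 528–529 and
proof of Lemma 7.4; M. W. Hirsch, *Differential Topology* (1976), Ch. 8 §3 Thm. 3.1 (finitely many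
points lie in a coordinate ball). Continues `FramedBallComplementEven.lean` (framing of `TX`
outside a removable ball ⟹ `Sq = 0` into the top degree) and `FiniteHomogeneity.lean` (finitely
many points are moved into any open set by a diffeomorphism):

* `HasTangentFramingAlong.pushforward` — **framings are pushed forward along equidimensional
  immersions**: a framing of `TM` along `g : S → M` and a `C¹` map `e : M → N` with everywhere
  invertible differential give the framing `(de ∘ sᵢ)` of `TN` along `e ∘ g` (continuity through
  the tangent map `Te`, Mathlib's `ContMDiff.continuous_tangentMap`);
* `HasTangentFramingAlong.compl_image_diffeomorph` — a framing of `TX` over `X ∖ F` pushed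
  forward along a self-diffeomorphism `ψ` is a framing over `X ∖ ψ(F)`;
* `steenrodSqLower_eq_zero_of_hasTangentFramingAlong_compl_finite`,
  `cupProduct_self_eq_zero_of_hasTangentFramingAlong_compl_finite`,
  `isEven_intersectionForm_of_hasTangentFramingAlong_compl_finite` — **for `X` closed, connected,
  smooth of dimension `n + 1 ≥ 2` whose tangent bundle is framed over the complement of a FINITE
  set: `Sq y = y ∪ y = 0` for all `y ∈ Hᵖ(X; ℤ/2)`, `p + p = n + 1`, and the intersection form of
  every `ℤ`-orientation is even** — move the finite set into a removable ball
  (`Diffeomorph.exists_image_subset_of_finite_euclidean`) and apply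
  `steenrodSqLower_eq_zero_of_hasTangentFramingAlong_compl_ball`.

Everything is proved; no definitions, no named facts. Written for the fact seat of
`Literature.AlgebraicGeometry.Surfaces.K3_even_intersectionForm` (a K3 surface is framed off the
finitely many critical points of a Morse function: holomorphic symplectic trivialisation).

## References

* A. Kosinski, *Differential Manifolds*, Academic Press 1993, Ch. IX §8, Ch. X Prop. (3.1).
  [Kosinski1993]
* M. Kervaire, J. Milnor, *Groups of homotopy spheres I*, Ann. of Math. 77 (1963), §7.
  [KervaireMilnorAnnals1963]
* M. W. Hirsch, *Differential Topology*, GTM 33 (1976), Ch. 4 §1–2, Ch. 8 §3 Thm. 3.1.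
  [HirschDT1976]
-/

open scoped Manifold ContDiff Topology
open Set Function Bundle Module
open Literature.AlgebraicTopology.SingularHomology

noncomputable section

namespace Literature.Topology.FourManifolds

/-! ### Pushing a framing forward along an equidimensional immersion -/

section Pushforward

variable {E : Type*} [NormedAddCommGroup E] [NormedSpace ℝ E]
  {E' : Type*} [NormedAddCommGroup E'] [NormedSpace ℝ E']
  {H : Type*} [TopologicalSpace H] {I : ModelWithCorners ℝ E H}
  {H' : Type*} [TopologicalSpace H'] {I' : ModelWithCorners ℝ E' H'}
  {M : Type*} [TopologicalSpace M] [ChartedSpace H M] [IsManifold I 1 M]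
  {N : Type*} [TopologicalSpace N] [ChartedSpace H' N] [IsManifold I' 1 N]
  {S : Type*} [TopologicalSpace S]

/-- **Framings are pushed forward along equidimensional immersions** (Hirsch 1976, Ch. 4 §1–2:
`TM ≅ e*TN` for an equidimensional immersion `e`). Let `e : M → N` be `C¹` with everywhere
invertible differential, `g : S → M`, and `(sᵢ)` a framing of `TM` along `g`. Then
`p ↦ de_{g p}(sᵢ p)` is a framing of `TN` along `e ∘ g`: continuity because the section is the
tangent map `Te` (continuous, `ContMDiff.continuous_tangentMap`) composed with the given
continuous section, independence because each `de_x` is injective; the two model vector spaces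
have the same dimension, and the frame is re-indexed accordingly. [cite: HirschDT1976, Ch. 4 §1 p. 88 and §2] -/
theorem HasTangentFramingAlong.pushforward {e : M → N} (he : ContMDiff I I' 1 e)
    (hinv : ∀ x, (mfderiv I I' e x).IsInvertible) {g : S → M}
    (h : HasTangentFramingAlong I M g) (hdim : finrank ℝ E = finrank ℝ E') :
    HasTangentFramingAlong I' N (e ∘ g) := by
  obtain ⟨s, hsc, hli⟩ := h
  refine ⟨fun i p => mfderiv I I' e (g p) (s (finCongr hdim.symm i) p), fun i => ?_, fun p => ?_⟩
  · -- the section is `Te ∘ (p ↦ ⟨g p, sⱼ p⟩)`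
    have hT : Continuous (tangentMap I I' e) := he.continuous_tangentMap le_rfl
    exact hT.comp (hsc (finCongr hdim.symm i))
  · -- `de_{g p}` is injective
    obtain ⟨L, hL⟩ := hinv (g p)
    have hker : LinearMap.ker (L.toLinearEquiv.toLinearMap) = ⊥ :=
      LinearMap.ker_eq_bot.2 L.injective
    have h1 : LinearIndependent ℝ (fun i => L (s i p)) :=
      (hli p).map' L.toLinearEquiv.toLinearMap hker
    have h1' := h1.comp _ (finCongr hdim.symm).injective
    have heq : (fun i => mfderiv I I' e (g p) (s (finCongr hdim.symm i) p)) =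
        (fun i => L (s i p)) ∘ finCongr hdim.symm := by
      funext i
      simp only [Function.comp_apply, ← hL, ContinuousLinearEquiv.coe_coe]
    rw [heq]
    exact h1'

end Pushforward

/-! ### Framings off a finite set, moved off a ball -/

section Finite

variable {n : ℕ} {X : Type} [TopologicalSpace X] [T2Space X] [SecondCountableTopology X]
  [CompactSpace X] [ChartedSpace (EuclideanSpace ℝ (Fin (n + 1))) X] [IsManifold (𝓡 (n + 1)) ∞ X]

omit [T2Space X] [SecondCountableTopology X] [CompactSpace X] in
/-- **A framing over `X ∖ F` pushed forward along a self-diffeomorphism `ψ` is a framing over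
`X ∖ ψ(F)`** (push forward along `ψ`, then reparametrise `X ∖ ψ(F) ≅ X ∖ F` by `ψ⁻¹`).
[cite: HirschDT1976, Ch. 4 §1 p. 88 and §2] -/
theorem HasTangentFramingAlong.compl_image_diffeomorph {F : Set X}
    (h : HasTangentFramingAlong (𝓡 (n + 1)) X ((↑) : (Fᶜ : Set X) → X))
    (ψ : X ≃ₘ⟮𝓡 (n + 1), 𝓡 (n + 1)⟯ X) :
    HasTangentFramingAlong (𝓡 (n + 1)) X ((↑) : ((ψ '' F)ᶜ : Set X) → X) := by
  have hψ : ContMDiff (𝓡 (n + 1)) (𝓡 (n + 1)) 1 ψ := ψ.contMDiff.of_le (by exact_mod_cast le_top)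
  have hinv : ∀ x, (mfderiv (𝓡 (n + 1)) (𝓡 (n + 1)) ψ x).IsInvertible := fun x =>
    ⟨ψ.mfderivToContinuousLinearEquiv (by simp) x, ψ.mfderivToContinuousLinearEquiv_coe (by simp)⟩
  have hpush := h.pushforward hψ hinv rfl
  -- reparametrise by `ψ⁻¹ : X ∖ ψ(F) → X ∖ F`
  have hmem : ∀ u : ((ψ '' F)ᶜ : Set X), ψ.symm u ∈ (Fᶜ : Set X) := fun u hu =>
    u.2 ⟨ψ.symm u, hu, ψ.apply_symm_apply u⟩
  let g : C(((ψ '' F)ᶜ : Set X), (Fᶜ : Set X)) :=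
    ⟨fun u => ⟨ψ.symm u, hmem u⟩, (ψ.symm.continuous.comp continuous_subtype_val).subtype_mk _⟩
  have hcomp : (ψ ∘ ((↑) : (Fᶜ : Set X) → X)) ∘ g = ((↑) : ((ψ '' F)ᶜ : Set X) → X) := by
    funext u
    exact ψ.apply_symm_apply u
  exact hcomp ▸ hpush.comp g

open SmaleHomologySpheres in
/-- **`Sq` into the top degree vanishes on a closed connected manifold framed off a finite set**
(Kosinski's almost parallelizable manifolds, Ch. IX §8, framed version; Kervaire–Milnor 1963, §7).
For `X` closed, connected, smooth of dimension `n + 1` with `1 ≤ n`, a finite `F ⊆ X` and a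
framing of `TX` over `X ∖ F`: `Sq y = 0` for all `y ∈ Hᵖ(X; ℤ/2)`, `p + p = n + 1`. Proof: move
`F` into the open disc of a ball-removal datum by a diffeomorphism (Hirsch Ch. 8 §3 Thm. 3.1,
`Diffeomorph.exists_image_subset_of_finite_euclidean`), push the framing forward, and apply
`steenrodSqLower_eq_zero_of_hasTangentFramingAlong_compl_ball`.
[cite: Kosinski1993, Ch. IX §8 and Ch. X Prop. (3.1) (p. 205)] [cite: KervaireMilnorAnnals1963, §7, footnote pp. 528–529] [cite: HirschDT1976, Ch. 8 §3, Thm. 3.1 (k = 0)] -/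
theorem steenrodSqLower_eq_zero_of_hasTangentFramingAlong_compl_finite [ConnectedSpace X]
    (hn : 1 ≤ n) {p : ℕ} (hp : p + p = n + 1) {F : Set X} (hF : F.Finite)
    (hfr : HasTangentFramingAlong (𝓡 (n + 1)) X ((↑) : (Fᶜ : Set X) → X))
    (y : singularCohomology (ZMod 2) (ZMod 2) X p) : steenrodSqLower X p (n + 1) 0 y = 0 := by
  classical
  obtain ⟨x₀⟩ := (inferInstance : Nonempty X)
  obtain ⟨D, -⟩ := exists_ballRemovalData (n := n) x₀
  -- the open disc `i(B̊)` is open and nonempty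
  set V : Set X := discX D '' Metric.ball 0 1 with hV
  have hVo : IsOpen V := (isOpenEmbedding_discX D).isOpenMap _ Metric.isOpen_ball
  have hVne : V.Nonempty := ⟨discX D 0, mem_image_of_mem _ (Metric.mem_ball_self one_pos)⟩
  -- move `F` into the disc
  obtain ⟨ψ, hψ⟩ := Diffeomorph.exists_image_subset_of_finite_euclidean (n := n + 1) (by omega) X
    hF hVo hVne
  have hfr' := hfr.compl_image_diffeomorph ψ
  have hsub : Vᶜ ⊆ (ψ '' F)ᶜ := compl_subset_compl.2 hψ
  exact steenrodSqLower_eq_zero_of_hasTangentFramingAlong_compl_ball (by omega) hp D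
    (hfr'.comp ⟨Set.inclusion hsub, continuous_inclusion hsub⟩) y

/-- **Cup squares vanish mod `2` on a closed connected manifold framed off a finite set**:
`y ∪ y = 0` for all `y ∈ Hᵖ(X; ℤ/2)`, `p + p = n + 1`, `1 ≤ n`.
[cite: Kosinski1993, Ch. IX §8 and Ch. X Prop. (3.1) (p. 205)] [cite: KervaireMilnorAnnals1963, §7, footnote pp. 528–529] -/
theorem cupProduct_self_eq_zero_of_hasTangentFramingAlong_compl_finite [ConnectedSpace X]
    (hn : 1 ≤ n) {p : ℕ} (hp : p + p = n + 1) {F : Set X} (hF : F.Finite)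
    (hfr : HasTangentFramingAlong (𝓡 (n + 1)) X ((↑) : (Fᶜ : Set X) → X))
    (y : singularCohomology (ZMod 2) (ZMod 2) X p) : cupProduct hp y y = 0 := by
  rw [← steenrodSqLower_zero_eq_cupProduct_self hp]
  exact steenrodSqLower_eq_zero_of_hasTangentFramingAlong_compl_finite hn hp hF hfr y

/-- **The intersection form of a closed connected manifold framed off a finite set is even**
(every `ℤ`-orientation; `k + k = n + 1`, `1 ≤ n`).
[cite: Kosinski1993, Ch. IX §8 and Ch. X Prop. (3.1) (p. 205)] [cite: KervaireMilnorAnnals1963, §7, footnote pp. 528–529] -/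
theorem isEven_intersectionForm_of_hasTangentFramingAlong_compl_finite [ConnectedSpace X]
    (hn : 1 ≤ n) {k : ℕ} (hk : k + k = n + 1) {F : Set X} (hF : F.Finite)
    (hfr : HasTangentFramingAlong (𝓡 (n + 1)) X ((↑) : (Fᶜ : Set X) → X))
    (μ : HomologicalOrientation ℤ X (n + 1)) : (intersectionForm hk μ).IsEven :=
  isEven_intersectionForm_of_steenrodSqLower_eq_zero hk μ fun y =>
    steenrodSqLower_eq_zero_of_hasTangentFramingAlong_compl_finite hn hk hF hfr y

end Finite

end Literature.Topology.FourManifolds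

end
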